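import Mathlib
import Summits.Ventures.PercRepro.TriangleCapRowA1
import Summits.Ventures.PercRepro.TriangleCapRowA1CapRefMain
import Summits.Ventures.PercRepro.TriangleCapRowA1Last6

/-!
# PercRepro — THE ROW `r = a + 1` OF THE STABILITY TABLE FOR EVERY `6 ≤ a ≤ 18`: the cells `(k, 6, 7)` and
`(k, 7, 8)` join the row (p3, gen 47; part 200zb)

`rowA1_second_order_gen` of part 200w (`a ≥ 8`) re-assembled for `a ≥ 6` from the refined cap `cap_A1_gen'` (part
200y: the joint accounting through the number of deficit vertices), the arithmetic of part 200z and the last mixed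
case of part 200za; the window, the sides, the witness (`doubleBroom`, `a ≥ 4`) and the deletion structure are those
of part 200w unchanged. `rowA1_nonbip_second_best'`: on `(k, a, a + 1)`, `6 ≤ a ≤ 18`, `3a + 1 ≤ k`, the
non-`a`-bipartite second-best value is EXACTLY `m k − (a + 1)(k − a − 2) − (2k − 10)`. Open: `(k, 5, 6)` (the cap
at `a = 5` has `M ≤ 2` only). Axioms: standard.
-/

namespace PercRepro

namespace TriangleCap

namespace C047

open Finset

variable {V : Type*} [Fintype V] [DecidableEq V]

/-- **THE ROW `r = a + 1`, `6 ≤ a ≤ 18`, `3a + 1 ≤ k`:** `K₄⁻`-free, `m + (a + 1) = a (k − a)` ⇒ `a`-bipartite or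
`Σ_v d(v)² + (a + 1)(k − 1 − (a + 1)) + (2k − 10) ≤ m k`. -/
theorem rowA1_second_order_gen' (D : SimpleGraph V) [DecidableRel D.Adj] (hK : K4mFree D) (a : ℕ)
    (ha6 : 6 ≤ a) (ha18 : a ≤ 18) (hk : 3 * a + 1 ≤ Fintype.card V)
    (hm : D.edgeFinset.card + (a + 1) = a * (Fintype.card V - a)) :
    (∃ A : Finset V, A.card = a ∧ BipSub D A) ∨
      ∑ v, deg D v * deg D v + (a + 1) * (Fintype.card V - 1 - (a + 1)) + (2 * Fintype.card V - 10) ≤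
        D.edgeFinset.card * Fintype.card V := by
  have hk2 : 2 * a + 2 ≤ Fintype.card V := by omega
  -- (A) a vertex at the cap
  by_cases hx : ∃ x, deg D x + a = Fintype.card V
  · obtain ⟨x, hx⟩ := hx
    exact cap_A1_gen' D hK a ha6 hk hm x hx
  push Not at hx
  have hcap : ∀ v, deg D v + a ≤ Fintype.card V := fun v =>
    deg_add_le_card_of_dense D hK a (by omega) (by omega)
      (cap_arith a (Fintype.card V) D.edgeFinset.card (a + 1) (by omega) (by omega)
        (below_cap_arith a (Fintype.card V) D.edgeFinset.card (a + 1) (by omega) hm)) v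
  have hcap' : ∀ v, deg D v + a + 1 ≤ Fintype.card V := fun v => by
    have h1 := hcap v
    have h2 := hx v
    omega
  have hcap2 : ∀ v, deg D v ≤ (Fintype.card V - a - 2) + 1 := fun v => by have := hcap' v; omega
  -- (B) every degree `≥ a`: the window
  by_cases hdeg : ∀ v, a ≤ deg D v
  · exact Or.inr (rowA1_window D a (by omega) hk hm hcap' hdeg)
  push Not at hdeg
  obtain ⟨z, hz⟩ := hdeg
  -- the deletion bookkeeping: `D − z` on `(k − 1, a, d + 1)`
  have hK' := k4mFree_del D hK z
  have hcard' := card_del z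
  have hedges' := card_edges_del D z
  have hsq := sum_deg_sq_del D z
  have hT := sum_del_nbhd_le D z (Fintype.card V - a - 2) hcap2
  obtain ⟨T, hTdef⟩ : ∃ T, ∑ w : {v : V // v ≠ z}, (if D.Adj w.1 z then deg (del D z) w else 0) = T := ⟨_, rfl⟩
  obtain ⟨S', hS'def⟩ : ∃ S', ∑ w : {v : V // v ≠ z}, deg (del D z) w * deg (del D z) w = S' := ⟨_, rfl⟩
  obtain ⟨m', hm'def⟩ : ∃ m', (del D z).edgeFinset.card = m' := ⟨_, rfl⟩
  rw [hTdef, hS'def] at hsq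
  rw [hTdef] at hT
  rw [hm'def] at hedges'
  have hcardV' : Fintype.card {v : V // v ≠ z} = Fintype.card V - 1 := by omega
  have hm' : (del D z).edgeFinset.card + (deg D z + 1) = a * (Fintype.card {v : V // v ≠ z} - a) := by
    rw [hm'def, hcardV']
    exact below_cell_edges a (a + 1) (deg D z + 1) (deg D z) (Fintype.card V) D.edgeFinset.card m' hk2 (by omega)
      hedges' hm
  have hmd : m' + deg D z + (a + 1) = a * (Fintype.card V - a) := by omega
  have hside : ∀ A' : Finset {v : V // v ≠ z}, A'.card = a → BipSub (del D z) A' →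
      (∃ A : Finset V, A.card = a ∧ BipSub D A) ∨
        (∑ v, deg D v * deg D v + (a + 1) * (Fintype.card V - 1 - (a + 1)) + (2 * Fintype.card V - 10) ≤
          D.edgeFinset.card * Fintype.card V) ∨
        (2 ≤ deg D z ∧ T + (Fintype.card V - a - 2) ≤ deg D z * (Fintype.card V - a - 2) + a) := by
    intro A' hA'card hB
    have := sides_A1_gen D a (by omega) hk hm z (by omega) A' hA'card hB hm' hcap2
    rw [hTdef] at this
    exact this
  rcases Nat.lt_or_ge (deg D z + 3) a with hd4 | hd4
  · -- `d ≤ a − 4`: a `B2` cell `(k − 1, a, d + 1)`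
    rcases below_second_order_all (del D z) hK' a (deg D z + 1) (by omega) ha18 (by omega) (by omega) hm'
      with ⟨A', hA'card, hB⟩ | hgap
    · rcases hside A' hA'card hB with h | h | ⟨h2, hT'⟩
      · exact Or.inl h
      · exact Or.inr h
      · right
        have hS := sum_deg_sq_le_of_bipSub (del D z) A' hB a (deg D z + 1) hA'card hm' (by omega)
        rw [hS'def, hm'def, hcardV'] at hS
        rw [hsq, ← hedges']
        exact rowA1_mixed' a (deg D z) (Fintype.card V) m' S' T ha6 h2 (by omega) hk hmd hS hT'
    · right
      rw [hS'def, hm'def, hcardV'] at hgap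
      rw [hsq, ← hedges']
      exact rowA1_del_B2' a (deg D z) (Fintype.card V) m' S' T ha6 (by omega) hk hmd hgap hT
  · rcases Nat.lt_or_ge (deg D z + 2) a with hd3 | hd3
    · -- `d = a − 3`: the `T` cell
      have hda : deg D z = a - 3 := by omega
      have hr' : deg D z + 1 = a - 2 := by omega
      rw [hr'] at hm'
      rw [hda] at hT hedges' hmd
      rcases rowT_second_order_gen (del D z) hK' a (a - 2) (by omega) ha18 (by omega) (by omega) hm'
        with ⟨A', hA'card, hB⟩ | hgap
      · rw [← hr'] at hm'
        rcases hside A' hA'card hB with h | h | ⟨h2, hT'⟩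
        · exact Or.inl h
        · exact Or.inr h
        · right
          have hS := sum_deg_sq_le_of_bipSub (del D z) A' hB a (deg D z + 1) hA'card hm' (by omega)
          rw [hS'def, hm'def, hcardV'] at hS
          rw [hda] at hT' h2 hS
          rw [hsq, ← hedges', hda]
          exact rowA1_mixed' a (a - 3) (Fintype.card V) m' S' T ha6 h2 (by omega) hk hmd hS hT'
      · right
        rw [hS'def, hm'def, hcardV'] at hgap
        rw [hsq, ← hedges', hda]
        exact rowA1_del_T' a (Fintype.card V) m' S' T ha6 hk hmd hgap hT
    · rcases Nat.lt_or_ge (deg D z + 1) a with hd2 | hd2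
      · -- `d = a − 2`: the `B2` cell `r′ = a − 1`
        have hda : deg D z = a - 2 := by omega
        have hr' : deg D z + 1 = a - 1 := by omega
        rw [hr'] at hm'
        rw [hda] at hT hedges' hmd
        rcases rowB_second_order_all (del D z) hK' a (a - 1) (by omega) ha18 (by omega) (by omega) hm'
          with ⟨A', hA'card, hB⟩ | hgap
        · rw [← hr'] at hm'
          rcases hside A' hA'card hB with h | h | ⟨h2, hT'⟩
          · exact Or.inl h
          · exact Or.inr h
          · right
            have hS := sum_deg_sq_le_of_bipSub (del D z) A' hB a (deg D z + 1) hA'card hm' (by omega)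
            rw [hS'def, hm'def, hcardV'] at hS
            rw [hda] at hT' h2 hS
            rw [hsq, ← hedges', hda]
            exact rowA1_mixed' a (a - 2) (Fintype.card V) m' S' T ha6 h2 (by omega) hk hmd hS hT'
        · right
          rw [hS'def, hm'def, hcardV'] at hgap
          rw [hsq, ← hedges', hda]
          exact rowA1_del_B' a (Fintype.card V) m' S' T ha6 hk hmd hgap hT
      · -- `d = a − 1`: the cell `r′ = a` and the last mixed case
        have hda : deg D z = a - 1 := by omega
        have hr' : deg D z + 1 = a := by omega
        have hm'a : (del D z).edgeFinset.card + a = a * (Fintype.card {v : V // v ≠ z} - a) := by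
          have h := hm'
          rw [hr'] at h
          exact h
        rcases rowA_second_order_gen (del D z) hK' a (by omega) ha18 (by omega) hm'a
          with ⟨A', hA'card, hB⟩ | hgap
        · by_cases hall : ∀ w : {v : V // v ≠ z}, D.Adj w.1 z → w ∈ A'
          · obtain ⟨B, hBcard, hBsub⟩ := bipSub_lift D z A' hB hall
            exact Or.inl ⟨B, by rw [hBcard, hA'card], hBsub⟩
          push Not at hall
          obtain ⟨w₀, hw₀z, hw₀A⟩ := hall
          by_cases hnone : ∀ w : {v : V // v ≠ z}, D.Adj w.1 z → w ∉ A'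
          · exact Or.inr (rowA1_alloff D a (by omega) hk hm z (by omega) A' hA'card hB hm' hnone w₀ hw₀z)
          push Not at hnone
          obtain ⟨w₁, hw₁z, hw₁A⟩ := hnone
          exact Or.inr (rowA1_last_mixed' D hK a ha6 hk hm z hda A' hA'card hB hm'a hcap2 w₀ hw₀A hw₀z w₁ hw₁A
            hw₁z)
        · right
          rw [hS'def, hm'def, hcardV'] at hgap
          rw [hda] at hT hedges' hmd
          rw [hsq, ← hedges', hda]
          exact rowA1_del_A' a (Fintype.card V) m' S' T ha6 hk hmd hgap hT

/-- **THE NON-BIPARTITE SECOND-BEST VALUE ON THE CELL `(k, a, a + 1)`, `6 ≤ a ≤ 18`, `3a + 1 ≤ k`:** EXACTLY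
`m k − (a + 1)(k − a − 2) − (2k − 10)`, attained by the double broom. -/
theorem rowA1_nonbip_second_best' (k a : ℕ) (ha6 : 6 ≤ a) (ha18 : a ≤ 18) (hk : 3 * a + 1 ≤ k) :
    (∀ (D : SimpleGraph (Fin k)) [DecidableRel D.Adj], K4mFree D → D.edgeFinset.card + (a + 1) = a * (k - a) →
        (¬ ∃ A : Finset (Fin k), A.card = a ∧ BipSub D A) →
        ∑ v, deg D v * deg D v + (a + 1) * (k - 1 - (a + 1)) + (2 * k - 10) ≤ D.edgeFinset.card * k) ∧
      ∃ (D : SimpleGraph (Fin k)) (_ : DecidableRel D.Adj), K4mFree D ∧ D.edgeFinset.card + (a + 1) = a * (k - a) ∧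
        (¬ ∃ A : Finset (Fin k), A.card = a ∧ BipSub D A) ∧
        ∑ v, deg D v * deg D v + (a + 1) * (k - 1 - (a + 1)) + (2 * k - 10) = D.edgeFinset.card * k := by
  have hcard : Fintype.card (Fin k) = k := Fintype.card_fin k
  refine ⟨?_, ?_⟩
  · intro D _ hK hm hnb
    rcases rowA1_second_order_gen' D hK a ha6 ha18 (by rw [hcard]; exact hk) (by rw [hcard]; exact hm) with h | h
    · exact absurd h hnb
    · rw [hcard] at h
      exact h
  · obtain ⟨hK, hE, hnb, hS⟩ := rowA1_witness k a (by omega) hk (by omega) (by omega) (by omega)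
    exact ⟨_, inferInstance, hK, hE, hnb, hS⟩

end C047

end TriangleCap

end PercRepro
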